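import Mathlib.GroupTheory.Index
import Mathlib.Algebra.Module.Torsion.Basic
import Mathlib.LinearAlgebra.Span.Basic
import HarnessLib

/-!
# The A-side junction of crux M's level-0 ledger, abstract algebra: for a homomorphism `f : M → G`, a subgroup
# `K' ≤ G` and subgroups `Y ≤ A ≤ M` with `n·A ≤ Y` and `Y ∩ f⁻¹K' ≤ n·Y`, the images in `G/K'` satisfy
# `[f(Y) : f(Y) ∩ K'] · [A : Y] ≤ [f(A) : f(A) ∩ K'] · #A[n]`
# (route `KatoDescentPotSupersingular` / `…Tame…`, crux M = stmt-BirchSwinnertonDyer-19196; route-free helper)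

Seat `bsd-potss-rkm` g20 (prover; cell `bsd-potss`), item stmt-BirchSwinnertonDyer-19196 (`--supports … --as helper`; closes nothing).
HONEST FRAMING: BSD is not proved by any of this; nothing is booked; theorems only (no definition, no named fact).  Pure group theory.

## Why (Kato, proof of Prop. 14.16 (2), p. 245, the step `[H¹_{/f}(ℚ_p,T) : z_p] = [H¹_{/f} : loc_p A]·[A : z]/#A_tors`)

The S-side of crux M's level-0 ledger (parts 33–46, `KatoFiniteLevelCount.exists_forall_sSide_le`) bounds
`#Sel_{p^∞} · ∏ #H¹_ur · [B_k(A) : B_k(A) ⊓ 𝓚_k^⊥]` where `B_k(A)` is the image of Kato's `A = H¹(ℤ[1/p], T_pE)` under the level-`p^k`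
localisation-at-`p` map `f_k` and `𝓚_k^⊥ = K'` is the orthogonal of the local Kummer condition.  Brick (b) (Kato 14.18 with the value of
the dual exponential) is a statement about ONE element `y₀ ∈ A` (the zeta element), i.e. about `B_k(ℤ_p y₀)`.  The junction between the
two is the elementary index computation of this file, written for an arbitrary additive homomorphism `f : M →+ G`, `K' ≤ G`, `Y ≤ A ≤ M`:

* `relIndex_map_inf_eq_relIndex_comap` — `[f(X) : f(X) ⊓ K'] = [X : X ⊓ f⁻¹K']` (the quantity of the S-side is an index in `M`);
* `relIndex_comap_mul_relIndex_eq` — with `L = f⁻¹K'`: `[Y : Y ⊓ L] · [A : Y] = [A : A ⊓ L] · [A ⊓ L : Y ⊓ L]` (two ways of computing `[A : Y ⊓ L]`);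
* `inf_comap_le_sup_torsionBy` — if `n • A ≤ Y` and `Y ⊓ L ≤ n • Y` then `A ⊓ L ≤ Y ⊔ A[n]` (`A[n] = A ⊓ M[n]`);
* `relIndex_inf_comap_le_natCard_torsion` — hence `[A ⊓ L : Y ⊓ L] ≤ #A[n]` (when `A[n]` is finite);
* **`relIndex_comap_mul_relIndex_le`** / **`relIndex_map_mul_relIndex_le`** — `[Y : Y ⊓ L] · [A : Y] ≤ [A : A ⊓ L] · #A[n]`, also in the
  image currency `[f(Y) : f(Y) ⊓ K'] · [A : Y] ≤ [f(A) : f(A) ⊓ K'] · #A[n]`;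
* `exists_mem_smul_eq_of_span_singleton` — the hypothesis `Y ⊓ L ≤ n • Y` for `Y = R ∙ y₀` from its divisibility form
  `f (c • y₀) ∈ K' → n ∣ c`.

In the application (part 48) `n = p^N` with `p^N A ≤ ℤ_p y₀` (finite index of the zeta line, Thm. 14.5 (2)), and the second hypothesis is the
finite-level form of `[H¹_{/f}(ℚ_p, T_pE) : ℤ_p loc_p y₀] = p^e`, `k ≥ N + e` (brick (b)).

References: K. Kato, Astérisque 295 (2004), proof of Prop. 14.16 (2) (pp. 244–245) [Kato2004Asterisque].
-/

-- the summit and its single problem are both named `BirchSwinnertonDyer` (registry layout D-0017)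
set_option linter.dupNamespace false
set_option autoImplicit false

open scoped AddSubgroup

namespace Summit.BirchSwinnertonDyer.BirchSwinnertonDyer.Theorems.ASideJunction

section Abstract

variable {M G : Type*} [AddCommGroup M] [AddCommGroup G] (f : M →+ G) (K' : AddSubgroup G)

/-- **`[f(X) : f(X) ⊓ K'] = [X : X ⊓ f⁻¹(K')]`**: the index of the S-side (written `(f(X) ⊓ K').relIndex f(X)`) is the relative index of
`f⁻¹K'` in `X`. [cite: Kato2004Asterisque, proof of Prop. 14.16 (2) (pp. 244–245)] -/
theorem relIndex_map_inf_eq_relIndex_comap (X : AddSubgroup M) :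
    (X.map f ⊓ K').relIndex (X.map f) = (K'.comap f).relIndex X := by
  rw [AddSubgroup.inf_relIndex_left, AddSubgroup.relIndex_comap]

/-- **Two ways of computing `[A : Y ⊓ L]`** (`L = f⁻¹K'`, `Y ≤ A`): `[Y : Y ⊓ L] · [A : Y] = [A : A ⊓ L] · [A ⊓ L : Y ⊓ L]`.
[cite: Kato2004Asterisque, proof of Prop. 14.16 (2) (pp. 244–245)] -/
theorem relIndex_comap_mul_relIndex_eq (A Y : AddSubgroup M) (hYA : Y ≤ A) :
    (K'.comap f).relIndex Y * Y.relIndex A =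
      (K'.comap f).relIndex A * (Y ⊓ K'.comap f).relIndex (A ⊓ K'.comap f) := by
  set L := K'.comap f
  have h1 : (Y ⊓ L).relIndex Y * Y.relIndex A = (Y ⊓ L).relIndex A :=
    AddSubgroup.relIndex_mul_relIndex (Y ⊓ L) Y A inf_le_left hYA
  have h2 : (Y ⊓ L).relIndex (A ⊓ L) * (A ⊓ L).relIndex A = (Y ⊓ L).relIndex A :=
    AddSubgroup.relIndex_mul_relIndex (Y ⊓ L) (A ⊓ L) A (inf_le_inf_right L hYA) inf_le_left
  rw [AddSubgroup.inf_relIndex_left] at h1 h2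
  rw [h1, ← h2, mul_comm]

/-- **`A ⊓ f⁻¹K' ≤ Y ⊔ A[n]`** as soon as `n • A ≤ Y` and `Y ⊓ f⁻¹K' ≤ n • Y`: for `a ∈ A` with `f a ∈ K'`, `n • a ∈ Y ⊓ f⁻¹K'`, so
`n • a = n • y'` with `y' ∈ Y`, and `a = y' + (a − y')` with `n • (a − y') = 0`. [cite: Kato2004Asterisque, proof of Prop. 14.16 (2) (pp. 244–245)] -/
theorem inf_comap_le_sup_torsionBy (A Y : AddSubgroup M) (hYA : Y ≤ A) (n : ℤ)
    (h1 : ∀ a ∈ A, n • a ∈ Y) (h2 : ∀ y ∈ Y, f y ∈ K' → ∃ y' ∈ Y, n • y' = y) :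
    A ⊓ K'.comap f ≤ Y ⊔ A ⊓ M[n] := by
  intro a ha
  obtain ⟨haA, haL⟩ := AddSubgroup.mem_inf.mp ha
  have hna : n • a ∈ Y := h1 a haA
  have hnaL : f (n • a) ∈ K' := by
    rw [map_zsmul]
    exact K'.zsmul_mem (AddSubgroup.mem_comap.mp haL) n
  obtain ⟨y', hy', hny'⟩ := h2 (n • a) hna hnaL
  have ht : a - y' ∈ A ⊓ M[n] := by
    refine AddSubgroup.mem_inf.mpr ⟨A.sub_mem haA (hYA hy'), ?_⟩
    change a - y' ∈ (Submodule.torsionBy ℤ M n).toAddSubgroup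
    rw [Submodule.mem_toAddSubgroup, Submodule.mem_torsionBy_iff, smul_sub, hny', sub_self]
  have : a = y' + (a - y') := by abel
  rw [this]
  exact AddSubgroup.add_mem _ (AddSubgroup.mem_sup_left hy') (AddSubgroup.mem_sup_right ht)

/-- **`[A ⊓ L : Y ⊓ L] ≤ #A[n]`** (`L = f⁻¹K'`, `A[n] = A ⊓ M[n]` finite) under `n • A ≤ Y` and `Y ⊓ L ≤ n • Y`:
`[A ⊓ L : Y ⊓ L] = [A ⊓ L : Y ⊓ (A ⊓ L)] ≤ [Y ⊔ A[n] : Y] = [A[n] : A[n] ⊓ Y] ≤ #A[n]`. [cite: Kato2004Asterisque, proof of Prop. 14.16 (2) (pp. 244–245)] -/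
theorem relIndex_inf_comap_le_natCard_torsion (A Y : AddSubgroup M) (hYA : Y ≤ A) (n : ℤ)
    (h1 : ∀ a ∈ A, n • a ∈ Y) (h2 : ∀ y ∈ Y, f y ∈ K' → ∃ y' ∈ Y, n • y' = y)
    [Finite ↥(A ⊓ M[n])] :
    (Y ⊓ K'.comap f).relIndex (A ⊓ K'.comap f) ≤ Nat.card ↥(A ⊓ M[n]) := by
  set L := K'.comap f
  set T := A ⊓ M[n]
  have hle : A ⊓ L ≤ Y ⊔ T := inf_comap_le_sup_torsionBy f K' A Y hYA n h1 h2
  have hdvd : Y.relIndex T ∣ Nat.card T := AddSubgroup.relIndex_dvd_card Y T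
  have hT : Y.relIndex T ≠ 0 := fun h => (Nat.card_pos (α := T)).ne' (Nat.eq_zero_of_zero_dvd (h ▸ hdvd))
  have hYT : Y.relIndex (Y ⊔ T) ≠ 0 := by rwa [AddSubgroup.relIndex_sup_left]
  have hYL : Y ⊓ L = Y ⊓ (A ⊓ L) := by rw [← inf_assoc, inf_of_le_left hYA]
  calc (Y ⊓ L).relIndex (A ⊓ L)
      = Y.relIndex (A ⊓ L) := by rw [hYL, AddSubgroup.inf_relIndex_right]
    _ ≤ Y.relIndex (Y ⊔ T) := AddSubgroup.relIndex_le_of_le_right hle hYT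
    _ = Y.relIndex T := AddSubgroup.relIndex_sup_left T Y
    _ ≤ Nat.card T := Nat.le_of_dvd Nat.card_pos hdvd

/-- **THE JUNCTION (index currency): `[Y : Y ⊓ f⁻¹K'] · [A : Y] ≤ [A : A ⊓ f⁻¹K'] · #A[n]`** for `Y ≤ A`, `n • A ≤ Y`,
`Y ⊓ f⁻¹K' ≤ n • Y`, `A[n]` finite. [cite: Kato2004Asterisque, proof of Prop. 14.16 (2) (pp. 244–245)] -/
theorem relIndex_comap_mul_relIndex_le (A Y : AddSubgroup M) (hYA : Y ≤ A) (n : ℤ)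
    (h1 : ∀ a ∈ A, n • a ∈ Y) (h2 : ∀ y ∈ Y, f y ∈ K' → ∃ y' ∈ Y, n • y' = y)
    [Finite ↥(A ⊓ M[n])] :
    (K'.comap f).relIndex Y * Y.relIndex A ≤ (K'.comap f).relIndex A * Nat.card ↥(A ⊓ M[n]) := by
  rw [relIndex_comap_mul_relIndex_eq f K' A Y hYA]
  exact Nat.mul_le_mul_left _ (relIndex_inf_comap_le_natCard_torsion f K' A Y hYA n h1 h2)

/-- **THE JUNCTION (image currency, the S-side's spelling): `[f(Y) : f(Y) ⊓ K'] · [A : Y] ≤ [f(A) : f(A) ⊓ K'] · #A[n]`** for `Y ≤ A`,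
`n • A ≤ Y`, `Y ⊓ f⁻¹K' ≤ n • Y`, `A[n]` finite. [cite: Kato2004Asterisque, proof of Prop. 14.16 (2) (pp. 244–245)] -/
theorem relIndex_map_mul_relIndex_le (A Y : AddSubgroup M) (hYA : Y ≤ A) (n : ℤ)
    (h1 : ∀ a ∈ A, n • a ∈ Y) (h2 : ∀ y ∈ Y, f y ∈ K' → ∃ y' ∈ Y, n • y' = y)
    [Finite ↥(A ⊓ M[n])] :
    (Y.map f ⊓ K').relIndex (Y.map f) * Y.relIndex A ≤ (A.map f ⊓ K').relIndex (A.map f) * Nat.card ↥(A ⊓ M[n]) := by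
  rw [relIndex_map_inf_eq_relIndex_comap, relIndex_map_inf_eq_relIndex_comap]
  exact relIndex_comap_mul_relIndex_le f K' A Y hYA n h1 h2

/-- A composite of three maps applied to a subgroup is one `map` (the S-side writes `B_k(X) = loc_p ((desc^♭)_* (ι′_* red_k X))`).
[cite: Kato2004Asterisque, proof of Prop. 14.16 (2) (pp. 244–245)] -/
theorem map_map_map_eq {G₁ G₂ : Type*} [AddCommGroup G₁] [AddCommGroup G₂] (f₁ : M →+ G₁) (f₂ : G₁ →+ G₂) (f₃ : G₂ →+ G)
    (X : AddSubgroup M) : ((X.map f₁).map f₂).map f₃ = X.map ((f₃.comp f₂).comp f₁) := by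
  rw [AddSubgroup.map_map, AddSubgroup.map_map]

end Abstract

section Span

variable {R M G : Type*} [CommRing R] [AddCommGroup M] [Module R M] [AddCommGroup G] (f : M →+ G) (K' : AddSubgroup G)

/-- **The second junction hypothesis for a cyclic `Y = R ∙ y₀` from its divisibility form**: if `f (c • y₀) ∈ K'` forces `n ∣ c` in `R`
(`n : ℤ` read in `R`), then every `y ∈ Y` with `f y ∈ K'` is `n • y'` with `y' ∈ Y`.  In the application `R = ℤ_p`, `y₀` Kato's zeta class,
`n = p^N`, and the divisibility is the finite-level form of `[H¹_{/f}(ℚ_p,T_pE) : ℤ_p loc_p y₀] = p^e` at a level `k ≥ N + e`.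
[cite: Kato2004Asterisque, Lemma 14.18 and proof of Prop. 14.16 (2) (pp. 244–248)] -/
theorem exists_mem_smul_eq_of_span_singleton (y₀ : M) (n : ℤ)
    (hdiv : ∀ c : R, f (c • y₀) ∈ K' → ∃ c' : R, c = (n : R) * c') :
    ∀ y ∈ (R ∙ y₀).toAddSubgroup, f y ∈ K' → ∃ y' ∈ (R ∙ y₀).toAddSubgroup, n • y' = y := by
  intro y hy hfy
  rw [Submodule.mem_toAddSubgroup, Submodule.mem_span_singleton] at hy
  obtain ⟨c, rfl⟩ := hy
  obtain ⟨c', rfl⟩ := hdiv c hfy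
  refine ⟨c' • y₀, ?_, ?_⟩
  · rw [Submodule.mem_toAddSubgroup]
    exact Submodule.smul_mem _ c' (Submodule.mem_span_singleton_self y₀)
  · rw [mul_smul, Int.cast_smul_eq_zsmul]

/-- **The first junction hypothesis for `Y = R ∙ y₀` from a finite index**: if `A ≤ M` is an `R`-submodule containing `y₀` with
`#(A ⧸ (R ∙ y₀)) = m ≠ 0` (finite index of the zeta line, Kato Thm. 14.5 (2)), then `m • A ≤ R ∙ y₀`.
[cite: Kato2004Asterisque, Thm. 14.5 (2) (p. 236) and proof of Prop. 14.16 (2) (pp. 244–245)] -/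
theorem index_smul_mem_span_singleton (A : Submodule R M) (y₀ : M) (hy₀ : y₀ ∈ A) (a : M) (ha : a ∈ A) :
    ((R ∙ y₀).toAddSubgroup.relIndex A.toAddSubgroup : ℤ) • a ∈ (R ∙ y₀).toAddSubgroup := by
  have hle : (R ∙ y₀).toAddSubgroup ≤ A.toAddSubgroup := by
    intro x hx
    rw [Submodule.mem_toAddSubgroup, Submodule.mem_span_singleton] at hx
    obtain ⟨c, rfl⟩ := hx
    exact A.smul_mem c hy₀
  have h := AddSubgroup.nsmul_index_mem ((R ∙ y₀).toAddSubgroup.addSubgroupOf A.toAddSubgroup) ⟨a, ha⟩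
  rw [AddSubgroup.mem_addSubgroupOf] at h
  rw [natCast_zsmul]
  exact h

end Span

end Summit.BirchSwinnertonDyer.BirchSwinnertonDyer.Theorems.ASideJunction
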